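import Literature.NumberTheory.Automorphic.RootData
import Literature.NumberTheory.Automorphic.TorusCharacters
import Mathlib.Algebra.Group.ForwardDiff
import Mathlib.LinearAlgebra.Semisimple
import HarnessLib

/-!
# One-parameter unipotent subgroups of `GL n`: unipotence, torus intersections, surjective characters
(trunk T-AUTOMORPHIC, G25 AutomorphicL; Springer, *Linear Algebraic Groups*, 2.4.5, 2.4.8, 3.2)

Theorems-only companion of `LinearAlgebraicGroups.lean`, `RootData.lean` and
`TorusCharacters.lean` (namespace `Literature.Automorphic`, concrete `k`-points vocabulary: subgroups of
`GL n k`, `IsUnipotentElt`, `IsSemisimpleElt`, `IsTorusSubgroup`, algebraic homomorphisms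
`IsAlgebraicAddHom u` for `u : 𝔾ₐ → G`, root homomorphisms `IsRootHom`, the character group
`characterLattice T`). Elementary inputs of the structure theory of reductive groups of
semisimple rank one (Springer 7.2–7.3: the Borel subgroups `B = T · U_α`, the normal form
`u(x) n t u(y)` of 7.2.4), all proved:

* `IsAlgebraicAddHom.isUnipotentElt` — **the image of an algebraic homomorphism `u : 𝔾ₐ → GL n`
  consists of unipotent matrices** (Springer 2.4.8 (ii): morphisms preserve unipotent parts, and
  `𝔾ₐ ≅ 𝕌₂` is unipotent). Direct proof, valid over any field: the entries of `u(x)^m = u(m x)`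
  are polynomials in `m` of degree `< N`, so their `N`-th finite difference
  `∑ₗ (-1)^{N-l} (N choose l) u(x)^l = (u(x) - 1)^N` vanishes (Mathlib
  `Polynomial.fwdDiff_iter_eq_zero_of_degree_lt`, `fwdDiff_iter_eq_sum_shift`);
  `IsAlgebraicAddHom.isUnipotentSubgroup_map_range`.
* `IsSemisimpleElt.eq_one_of_isUnipotentElt` — a semisimple unipotent matrix is `1` (Springer
  2.4.5, uniqueness of the Jordan decomposition; Mathlib
  `Module.End.eq_zero_of_isNilpotent_isSemisimple`); hence a torus meets a unipotent subgroup
  trivially (`IsTorusSubgroup.inf_eq_bot_of_isUnipotentSubgroup`,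
  `IsAlgebraicAddHom.eq_one_of_mem_torus`) and the decomposition `t · u(x)` in `T · u(𝔾ₐ)` is
  unique (`IsAlgebraicAddHom.eq_of_inclusion_mul_eq`; Springer 6.3.5 (iv) for `B = T · U`).
* `surjective_of_ne_one_of_mem_characterLattice` — **a non-trivial character of a torus over an
  algebraically closed field is surjective** (Springer 3.2: by the perfect pairing 3.2.11 (i),
  `exists_dualBases_of_isTorusSubgroup`, there is a cocharacter `λ` with `α ∘ λ = (x ↦ x^d)`,
  `d ≠ 0`, and `d`-th roots exist).

## Mathlib

Forward differences (`fwdDiff`, `Polynomial.fwdDiff_iter_eq_zero_of_degree_lt`), semisimple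
endomorphisms (`Module.End.IsSemisimple`, `Module.End.isSemisimple_sub_algebraMap_iff`,
`Module.End.eq_zero_of_isNilpotent_isSemisimple`), `IsAlgClosed.exists_pow_nat_eq`. Mathlib has
no algebraic groups; nothing here duplicates a Mathlib declaration (searched `unipotent`,
`IsUnipotent` — only Lie-algebra / ring-theoretic notions).

## References

* [SpringerLAG1998] T. A. Springer, *Linear Algebraic Groups*, 2nd ed., Progress in Mathematics 9,
  Birkhäuser (1998): 2.4.5, 2.4.8 (ii), 2.4.12–2.4.13, 3.2.1, 3.2.11 (i), 6.3.5 (iv), 7.2.4.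
-/

open scoped MatrixGroups fwdDiff
open Polynomial

namespace Literature.NumberTheory.Automorphic

variable {k : Type*} [Field k] {n : Type*} [Fintype n] [DecidableEq n]

/-! ### Images of `𝔾ₐ` are unipotent -/

section Unipotent

variable {G : Subgroup (GL n k)}

/-- **Images of algebraic homomorphisms `𝔾ₐ → GL n` are unipotent** (Springer 2.4.8 (ii) with
2.4.5: a homomorphism of algebraic groups carries unipotent elements to unipotent elements, and
every element of `𝔾ₐ` is unipotent). Direct proof over any field: if the coordinates of `u(x)`
are polynomials in `x`, the entries of `u(x)^m = u(m x)` are polynomials in `m` of degree `< N`,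
so the `N`-th finite difference `∑ₗ (-1)^{N-l} (N choose l) u(x)^l = (u(x) - 1)^N` vanishes.
[cite: SpringerLAG1998, 2.4.8 (ii)] -/
theorem IsAlgebraicAddHom.isUnipotentElt {u : Multiplicative k →* ↥G} (hu : IsAlgebraicAddHom u)
    (x : k) : IsUnipotentElt ((u (Multiplicative.ofAdd x) : ↥G) : GL n k) := by
  classical
  obtain ⟨P, hP⟩ := hu
  set M : Matrix n n k := (((u (Multiplicative.ofAdd x) : ↥G) : GL n k) : Matrix n n k) with hM
  -- the entries of `M ^ m` are the values at `m` of polynomials `Q (i, j)`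
  set Q : n × n → k[X] := fun ij => (P (Sum.inl ij)).comp (X * C x) with hQ
  have hpow : ∀ (m : ℕ) (i j : n), (M ^ m) i j = (Q (i, j)).eval (m : k) := by
    intro m i j
    have h1 : M ^ m = ((u (Multiplicative.ofAdd ((m : k) * x)) : ↥G) : GL n k) := by
      rw [← nsmul_eq_mul, ofAdd_nsmul, map_pow, Subgroup.coe_pow, Units.val_pow_eq_pow_val]
    rw [h1, ← glCoordFun_inl, hP, hQ]
    simp only [eval_comp, eval_mul, eval_X, eval_C, mul_comm]
  -- a uniform bound on their degrees
  set N : ℕ := Finset.univ.sup (fun ij : n × n => (Q ij).natDegree) + 1 with hN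
  have hdeg : ∀ ij : n × n, (Q ij).natDegree < N := fun ij =>
    Nat.lt_succ_of_le (Finset.le_sup (f := fun ij : n × n => (Q ij).natDegree) (Finset.mem_univ ij))
  refine ⟨N, ?_⟩
  -- binomial expansion of `(M - 1) ^ N` and the vanishing finite difference, entry by entry
  have hcomm : Commute M (-1) := (Commute.one_right M).neg_right
  have hterm : ∀ l : ℕ, M ^ l * (-1) ^ (N - l) * (N.choose l : Matrix n n k) =
      ((-1 : k) ^ (N - l) * (N.choose l : k)) • M ^ l := by
    intro l
    have h1 : (-1 : Matrix n n k) = (-1 : k) • (1 : Matrix n n k) := by rw [neg_smul, one_smul]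
    have h2 : (N.choose l : Matrix n n k) = (N.choose l : k) • (1 : Matrix n n k) := by
      rw [Nat.cast_smul_eq_nsmul, Nat.smul_one_eq_cast]
    rw [h1, smul_pow, one_pow, h2, mul_smul_comm, mul_one, mul_smul_comm, mul_one, smul_smul,
      mul_comm]
  rw [sub_eq_add_neg, hcomm.add_pow]
  simp_rw [hterm]
  ext i j
  rw [Matrix.sum_apply, Matrix.zero_apply]
  have key := congr_fun (Polynomial.fwdDiff_iter_eq_zero_of_degree_lt (hdeg (i, j))) 0
  rw [fwdDiff_iter_eq_sum_shift, Pi.zero_apply] at key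
  rw [← key]
  refine Finset.sum_congr rfl fun l _ => ?_
  rw [Matrix.smul_apply, smul_eq_mul, hpow, zsmul_eq_mul, zero_add, Nat.smul_one_eq_cast]
  push_cast
  ring

/-- The image of an algebraic homomorphism `u : 𝔾ₐ → G` (in particular a root subgroup
`u_α(𝔾ₐ)`) is a unipotent subgroup (Springer 2.4.8 (ii)). [cite: SpringerLAG1998, 2.4.8 (ii)] -/
theorem IsAlgebraicAddHom.isUnipotentSubgroup_map_range {u : Multiplicative k →* ↥G}
    (hu : IsAlgebraicAddHom u) : IsUnipotentSubgroup (u.range.map G.subtype) := by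
  rintro _ ⟨_, ⟨x, rfl⟩, rfl⟩
  simpa using hu.isUnipotentElt (Multiplicative.toAdd x)

/-- The image of a root homomorphism consists of unipotent elements (Springer 8.1.1: `U_α` is a
unipotent subgroup). [cite: SpringerLAG1998, 2.4.8 (ii)] -/
theorem IsRootHom.isUnipotentElt {T : Subgroup (GL n k)} {hTG : T ≤ G} {α : ↥T →* kˣ}
    {u : Multiplicative k →* ↥G} (hu : IsRootHom G T hTG α u) (x : k) :
    IsUnipotentElt ((u (Multiplicative.ofAdd x) : ↥G) : GL n k) :=
  hu.1.isUnipotentElt x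

end Unipotent

/-! ### Semisimple and unipotent: tori meet unipotent subgroups trivially -/

section SemisimpleUnipotent

variable {G T : Subgroup (GL n k)}

/-- **A matrix that is both semisimple and unipotent is the identity** (Springer 2.4.5: the
multiplicative Jordan decomposition `a = a_s a_u` is unique; here `g = g · 1 = 1 · g`). Via
Mathlib: `g - 1` is nilpotent and semisimple, hence zero
(`Module.End.eq_zero_of_isNilpotent_isSemisimple`). [cite: SpringerLAG1998, 2.4.5] -/
theorem IsSemisimpleElt.eq_one_of_isUnipotentElt {g : GL n k} (hs : IsSemisimpleElt g)
    (hu : IsUnipotentElt g) : g = 1 := by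
  have h1 : IsNilpotent (Matrix.toLin' (g : Matrix n n k) - 1) := by
    have h := hu.map (Matrix.toLinAlgEquiv' (R := k) (n := n))
    rw [map_sub, map_one] at h
    exact h
  have h2 : Module.End.IsSemisimple (Matrix.toLin' (g : Matrix n n k) - 1) := by
    have h := (Module.End.isSemisimple_sub_algebraMap_iff (f := Matrix.toLin' (g : Matrix n n k))
      (μ := (1 : k))).2 hs
    rwa [map_one] at h
  have h3 := Module.End.eq_zero_of_isNilpotent_isSemisimple h1 h2
  rw [sub_eq_zero, Module.End.one_eq_id, ← Matrix.toLin'_one] at h3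
  exact Units.ext (Matrix.toLin'.injective h3)

/-- **A torus meets a unipotent subgroup trivially** (Springer 2.4.5; used in 6.3.5 (iv) and
7.2: `T ∩ U = {e}` for `B = T · U`). [cite: SpringerLAG1998, 2.4.5] -/
theorem IsTorusSubgroup.inf_eq_bot_of_isUnipotentSubgroup {U : Subgroup (GL n k)}
    (hT : IsTorusSubgroup T) (hU : IsUnipotentSubgroup U) : T ⊓ U = ⊥ := by
  rw [eq_bot_iff]
  intro g hg
  exact (IsSemisimpleElt.eq_one_of_isUnipotentElt (hT.2.2 g hg.1) (hU g hg.2) : g = 1)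

/-- An element of a torus `T` of the form `u(x)`, `u : 𝔾ₐ → G` algebraic, is `1`; in particular
`T ∩ U_α = {1}` for root subgroups (Springer 2.4.5, 7.2.3). [cite: SpringerLAG1998, 2.4.5] -/
theorem IsAlgebraicAddHom.eq_one_of_mem_torus (hT : IsTorusSubgroup T)
    {u : Multiplicative k →* ↥G} (hu : IsAlgebraicAddHom u) {x : k}
    (hx : ((u (Multiplicative.ofAdd x) : ↥G) : GL n k) ∈ T) :
    ((u (Multiplicative.ofAdd x) : ↥G) : GL n k) = 1 :=
  IsSemisimpleElt.eq_one_of_isUnipotentElt (hT.2.2 _ hx) (hu.isUnipotentElt x)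

/-- **Uniqueness of the decomposition `t · u(x)` in `T · u(𝔾ₐ)`** (Springer 6.3.5 (iv) for the
connected solvable group `B = T · U`; 7.2.4, relations (19)–(21)): for a torus `T ≤ G` and an
injective algebraic `u : 𝔾ₐ → G`, `t u(x) = t' u(x')` forces `t = t'` and `x = x'`.
[cite: SpringerLAG1998, 6.3.5 (iv)] -/
theorem IsAlgebraicAddHom.eq_of_inclusion_mul_eq (hT : IsTorusSubgroup T) (hTG : T ≤ G)
    {u : Multiplicative k →* ↥G} (hu : IsAlgebraicAddHom u) (hinj : Function.Injective u)
    {t t' : ↥T} {x x' : k}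
    (h : Subgroup.inclusion hTG t * u (Multiplicative.ofAdd x) =
      Subgroup.inclusion hTG t' * u (Multiplicative.ofAdd x')) : t = t' ∧ x = x' := by
  -- `t'⁻¹ t = u(x') u(x)⁻¹ = u(x' - x)` lies in `T`
  have h1 : (Subgroup.inclusion hTG t')⁻¹ * Subgroup.inclusion hTG t =
      u (Multiplicative.ofAdd (x' - x)) := by
    rw [ofAdd_sub, _root_.map_div, eq_div_iff_mul_eq', mul_assoc, inv_mul_eq_iff_eq_mul]
    exact h
  have hmem : ((u (Multiplicative.ofAdd (x' - x)) : ↥G) : GL n k) ∈ T := by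
    rw [← h1]
    exact T.mul_mem (T.inv_mem t'.2) t.2
  have hone := hu.eq_one_of_mem_torus hT hmem
  have hone' : u (Multiplicative.ofAdd (x' - x)) = 1 := Subtype.ext hone
  have hx : x = x' := by
    have h2 := hinj (hone'.trans (map_one u).symm)
    rw [← ofAdd_zero, Multiplicative.ofAdd.injective.eq_iff, sub_eq_zero] at h2
    exact h2.symm
  refine ⟨?_, hx⟩
  rw [hone', inv_mul_eq_one] at h1
  exact (Subgroup.inclusion_injective hTG h1).symm

end SemisimpleUnipotent

/-! ### Non-trivial characters of tori are surjective -/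

section Surjective

variable {T : Subgroup (GL n k)}

/-- **A non-trivial character of a torus over an algebraically closed field is surjective**
(Springer 3.2: in coordinates `T ≅ 𝔻ᵣ` a character is `t ↦ t^m` with `m ∈ ℤʳ`, non-zero for
`α ≠ 1`). Proof: by the perfect pairing 3.2.11 (i) (`exists_dualBases_of_isTorusSubgroup`) there
is a cocharacter `λ` with `⟨α, λ⟩ = d ≠ 0`, i.e. `α(λ(x)) = x^d` (`charPairingInt_spec_holds`),
and `d`-th roots exist in `k` (equivalently: `α(T)` is a non-trivial subtorus of `𝔾ₘ`, 3.2.7). Used in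
7.2.4 (homogeneity under `T`). [folklore] -/
theorem surjective_of_ne_one_of_mem_characterLattice [IsAlgClosed k] (hT : IsTorusSubgroup T)
    {α : ↥(characterLattice T)} (hα : α ≠ 1) : Function.Surjective (α : ↥T →* kˣ) := by
  haveI : IsMulCommutative ↥T := hT.2.1
  obtain ⟨r, bX, bY, hpair⟩ := exists_dualBases_of_isTorusSubgroup hT
  -- a coordinate `i` with `bX α i = d ≠ 0`
  have hne : bX (Additive.ofMul α) ≠ 0 := by
    intro h
    apply hα
    have : Additive.ofMul α = 0 := bX.injective (by rw [h, map_zero])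
    exact Additive.ofMul.injective this
  obtain ⟨i, hi⟩ : ∃ i, bX (Additive.ofMul α) i ≠ 0 := by
    by_contra! h
    exact hne (funext h)
  set d : ℤ := bX (Additive.ofMul α) i with hd
  set γ : ↥(cocharacterLattice T) := Additive.toMul (bY.symm (Pi.single i 1)) with hγ
  have hp : charPairingInt (α : ↥T →* kˣ) (γ : kˣ →* ↥T) = d := by
    rw [hpair, hγ]
    simp [Pi.single_apply, hd]
  intro y
  -- `d`-th roots in `kˣ`
  have hd0 : d ≠ 0 := hi
  obtain ⟨z, hz⟩ : ∃ z : kˣ, z ^ d = y := by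
    have hnat : d.natAbs ≠ 0 := Int.natAbs_ne_zero.2 hd0
    rcases Int.natAbs_eq d with hdpos | hdneg
    · obtain ⟨w, hw⟩ := IsAlgClosed.exists_pow_nat_eq (y : k) (Nat.pos_of_ne_zero hnat)
      have hw0 : w ≠ 0 := by
        rintro rfl
        rw [zero_pow hnat] at hw
        exact y.ne_zero hw.symm
      refine ⟨Units.mk0 w hw0, Units.ext ?_⟩
      rw [hdpos, zpow_natCast, Units.val_pow_eq_pow_val, Units.val_mk0, hw]
    · obtain ⟨w, hw⟩ := IsAlgClosed.exists_pow_nat_eq ((y⁻¹ : kˣ) : k) (Nat.pos_of_ne_zero hnat)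
      have hw0 : w ≠ 0 := by
        rintro rfl
        rw [zero_pow hnat] at hw
        exact (y⁻¹).ne_zero hw.symm
      refine ⟨Units.mk0 w hw0, ?_⟩
      rw [hdneg, zpow_neg, zpow_natCast, ← inv_inj, inv_inv]
      exact Units.ext (by rw [Units.val_pow_eq_pow_val, Units.val_mk0, hw])
  refine ⟨(γ : kˣ →* ↥T) z, ?_⟩
  rw [charPairingInt_spec_holds (T := T) α.2 γ.2 z, hp, hz]

/-- A root, being a non-trivial character, is surjective onto `kˣ` (for `T` a torus over an
algebraically closed field). [folklore] -/
theorem surjective_of_mem_roots [IsAlgClosed k] {G : Subgroup (GL n k)} (hT : IsTorusSubgroup T)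
    {α : ↥(characterLattice T)} (hα : α ∈ roots G T) : Function.Surjective (α : ↥T →* kˣ) :=
  surjective_of_ne_one_of_mem_characterLattice hT fun h => hα.1 (by rw [h, Subgroup.coe_one])

end Surjective

end Literature.NumberTheory.Automorphic
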